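import Summits.PneNP.PneNP.Theorems.NegLimitedAmplifiedWindowLadder
import Summits.PneNP.PneNP.Theorems.NegLimitedAmplifiedWindowRungSum
import Summits.PneNP.PneNP.Theorems.NegLimitedAmplifiedWindowSecondMoment
import Literature.Computability.Complexity.CliqueThresholdBounds
import Literature.Computability.Complexity.CliqueTestGraphs
import Mathlib
import HarnessLib

/-!
# Amplified critical window — the critical window of a balanced ladder, and the mean rung error
(cell pnp-ideate, rung F-N1/p3, ROUND-11; line `amplified-window` on item stmt-PneNP-19860, stub B
`CriticalWindowHardness`; card HOME/pnp-ideate-p3/r11/amplified-window.md §5 (e),(f), ROUND-11 §B.8)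

Deterministic (fixed-`n`) core of stub B, over the landed base helpers:

* `ladder_window` — if the sprinkling ladder `p_i = ladder p₀ q i` (`i < T`) is EXACTLY BALANCED
  (`Σ_{i<T} Pr_{p_i}[ω_k ≥ 1] = T/2`) and `T·q ≤ n^{-2/(k-1)}/(4C(k,2))`, then every rung sits in the
  critical window: `λ_i = C(n,k) p_i^{C(k,2)} ≥ 1/4` and `p_i ≤ 2b·n^{-2/(k-1)}` (`b = 4·2^k·k!`).
  Below: at `p* = b n^{-2/(k-1)}` one has `λ* ≥ 4` (`le_choose_mul_threshold_pow`) hence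
  `Pr_{p*}[ω_k ≥ 1] > 1/2` (Paley–Zygmund with `CriticalSecondMoment`), so `p_0 ≤ p*` by monotonicity;
  above: `λ_{T−1} ≥ Pr_{p_{T−1}}[ω_k ≥ 1] ≥ 1/2` (Markov) and `p_0 ≥ p_{T−1} − Tq` loses at most a factor
  `(1 − C(k,2)·Tq/p_{T−1}) ≥ 1/2` (Bernoulli).
* `mean_error_ge_of_window` — in the window, the rung inequalities (`rungStep_holds` fed by a
  `thm1_sparse_relative`-shaped pointwise bound for `g`) have `√M_i/λ_i ≤ 5/2`, and `rung_sum_bound` +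
  `mean_error_ge` give mean error `ē = (1/T) Σ_i Pr_{p_i}[g ≠ CLIQUE_k] ≥ 1/64` once `θ ≤ 1/50`,
  `T ≥ 100`, `32 K₂ ≤ n`.

HONEST FRAMING: bookkeeping for the OPEN stub B (its assembly is the next file); no unconditional
hardness is claimed here; FRONTIER rung F-N1 — nothing here bears on P vs NP.
-/

set_option linter.dupNamespace false -- `Summit.PneNP.PneNP.…`: summit = sub-problem name (D-0017 single-conjunct layout)

namespace Summit.PneNP.PneNP.Theorems.NegLimitedDoor.AmplifiedWindowBase

open Finset
open Literature.Computability.Complexity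

/-! ### The critical window of a balanced ladder -/

/-- **The balanced ladder sits in the critical window.**  See the module docstring. -/
theorem ladder_window {n k T : ℕ} (hk : 2 ≤ k) (hkn : 2 * k ≤ n) (hT : 1 ≤ T)
    {p₀ q b K₂ : ℝ} (hp0 : 0 ≤ p₀) (hp1 : p₀ ≤ 1) (hq0 : 0 ≤ q) (hq1 : q ≤ 1)
    (hb : 4 * 2 ^ k * (k.factorial : ℝ) ≤ b)
    (hbthr : b * (n : ℝ) ^ (-(2 : ℝ) / ((k : ℝ) - 1)) ≤ 1)
    (hTq : (T : ℝ) * q ≤ (n : ℝ) ^ (-(2 : ℝ) / ((k : ℝ) - 1)) / (4 * k.choose 2))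
    (hK₂ : ∀ p : ℝ, 0 ≤ p → p ≤ 1 → p ≤ 2 * b * (n : ℝ) ^ (-(2 : ℝ) / ((k : ℝ) - 1)) →
      ∑ x, gnpWeight n p x * (cliqueCount n k x : ℝ) ^ 2 ≤
        (n.choose k : ℝ) * p ^ k.choose 2 + ((n.choose k : ℝ) * p ^ k.choose 2) ^ 2 + K₂ / n)
    (hK₂n : K₂ ≤ n)
    (hbal : ∑ i ∈ range T, gnpProb n (ladder p₀ q i) (univ.filter fun x => cliqueFn n k x = true) =
      T / 2) :
    ∀ i ∈ range T, 1 / 4 ≤ (n.choose k : ℝ) * ladder p₀ q i ^ k.choose 2 ∧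
      ladder p₀ q i ≤ 2 * b * (n : ℝ) ^ (-(2 : ℝ) / ((k : ℝ) - 1)) := by
  classical
  set thr := (n : ℝ) ^ (-(2 : ℝ) / ((k : ℝ) - 1)) with hthr
  set C := k.choose 2 with hC
  set π : ℕ → ℝ := fun i => gnpProb n (ladder p₀ q i) (univ.filter fun x => cliqueFn n k x = true)
    with hπ
  have hn1 : 1 ≤ n := by omega
  have hn0 : (0 : ℝ) < n := by exact_mod_cast hn1
  have hthr0 : 0 < thr := Real.rpow_pos_of_pos hn0 _
  have hC1 : 1 ≤ C := by rw [hC]; exact Nat.succ_le_of_lt (Nat.choose_pos hk)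
  have hC0 : (0 : ℝ) < C := by exact_mod_cast hC1
  have hC1r : (1 : ℝ) ≤ C := by exact_mod_cast hC1
  have hfac : (0 : ℝ) < 2 ^ k * (k.factorial : ℝ) := by positivity
  have hfac1 : (1 : ℝ) ≤ 2 ^ k * (k.factorial : ℝ) :=
    one_le_mul_of_one_le_of_one_le (one_le_pow₀ (by norm_num))
      (by exact_mod_cast Nat.succ_le_of_lt (Nat.factorial_pos k))
  have hb1 : 1 ≤ b := by nlinarith
  have hb0 : 0 ≤ b := zero_le_one.trans hb1
  have hTpos : (0 : ℝ) < T := by exact_mod_cast hT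
  have hmono : Monotone (cliqueFn n k) := cliqueFn_monotone_holds n k
  -- ladder values lie in `[0,1]` and increase
  have hl0 : ∀ i, 0 ≤ ladder p₀ q i := fun i => ladder_nonneg hp0 hp1 hq0 hq1 i
  have hl1 : ∀ i, ladder p₀ q i ≤ 1 := fun i => ladder_le_one hp1 hq1 i
  have hπmono : ∀ {i j : ℕ}, i ≤ j → π i ≤ π j := fun {i j} hij =>
    gnpProb_mono_density (hl0 i) (ladder_mono hp1 hq0 hq1 hij) (hl1 j) hmono
  -- balance ⇒ `π 0 ≤ 1/2 ≤ π (T-1)`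
  have hπ0 : π 0 ≤ 1 / 2 := by
    by_contra h
    have h' : 1 / 2 < π 0 := not_le.mp h
    have : (T : ℝ) * π 0 ≤ ∑ i ∈ range T, π i := by
      calc (T : ℝ) * π 0 = ∑ i ∈ range T, π 0 := by rw [sum_const, card_range, nsmul_eq_mul]
        _ ≤ ∑ i ∈ range T, π i := sum_le_sum fun i _ => hπmono (Nat.zero_le i)
    rw [hbal] at this
    nlinarith
  have hπT : 1 / 2 ≤ π (T - 1) := by
    by_contra h
    have h' : π (T - 1) < 1 / 2 := not_le.mp h
    have : ∑ i ∈ range T, π i ≤ (T : ℝ) * π (T - 1) := by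
      calc ∑ i ∈ range T, π i ≤ ∑ i ∈ range T, π (T - 1) :=
            sum_le_sum fun i hi => hπmono (by have := mem_range.1 hi; omega)
        _ = (T : ℝ) * π (T - 1) := by rw [sum_const, card_range, nsmul_eq_mul]
    rw [hbal] at this
    nlinarith
  -- the reference density `p* = b·thr`: `λ* ≥ 4` and `Pr_{p*}[clique] > 1/2`
  have hps0 : 0 ≤ b * thr := mul_nonneg hb0 hthr0.le
  have hlam_star : 4 ≤ (n.choose k : ℝ) * (b * thr) ^ C := by
    have h := le_choose_mul_threshold_pow hk hkn hb0
    have hbC : b ≤ b ^ C := le_self_pow₀ hb1 (by omega)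
    have h4 : 4 ≤ b ^ C / (2 ^ k * (k.factorial : ℝ)) := by
      rw [le_div_iff₀ hfac]
      linarith
    exact h4.trans h
  have hπ_star : 1 / 2 < gnpProb n (b * thr) (univ.filter fun x => cliqueFn n k x = true) := by
    have hPZ := lambda_sq_le_secondMoment_mul_gnpProb (n := n) (k := k) hps0 hbthr
    have hM := hK₂ (b * thr) hps0 hbthr (by nlinarith [hthr0.le, hb0])
    set lam := (n.choose k : ℝ) * (b * thr) ^ C
    set M := ∑ x, gnpWeight n (b * thr) x * (cliqueCount n k x : ℝ) ^ 2
    set P := gnpProb n (b * thr) (univ.filter fun x => cliqueFn n k x = true)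
    have hP0 : 0 ≤ P := gnpProb_nonneg hps0 hbthr _
    have hKn : K₂ / n ≤ 1 := (div_le_one hn0).2 hK₂n
    by_contra hle
    have hP : P ≤ 1 / 2 := not_lt.mp hle
    have hM0 : 0 ≤ M := sum_nonneg fun x _ => mul_nonneg (gnpWeight_nonneg hps0 hbthr x) (sq_nonneg _)
    have h1 : lam ^ 2 ≤ M * (1 / 2) := hPZ.trans (mul_le_mul_of_nonneg_left hP hM0)
    nlinarith
  -- hence `p₀ ≤ p*`
  have hp0_star : p₀ ≤ b * thr := by
    by_contra h
    have hlt : b * thr < p₀ := not_le.mp h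
    have hmono' := gnpProb_mono_density (n := n) hps0 hlt.le hp1 hmono
    have : π 0 = gnpProb n p₀ (univ.filter fun x => cliqueFn n k x = true) := by
      simp only [hπ, ladder_zero]
    linarith
  -- `T q ≤ thr/(4C) ≤ b thr`
  have hTq' : (T : ℝ) * q ≤ b * thr := by
    refine hTq.trans ?_
    rw [div_le_iff₀ (by positivity)]
    have h1 : thr ≤ b * thr := le_mul_of_one_le_left hthr0.le hb1
    calc thr = thr * 1 := (mul_one _).symm
      _ ≤ b * thr * (4 * C) := mul_le_mul h1 (by linarith) zero_le_one (by positivity)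
  -- ### the upper window: `p_i ≤ 2 b thr`
  have hupper : ∀ i ∈ range T, ladder p₀ q i ≤ 2 * b * thr := by
    intro i hi
    have hiT : (i : ℝ) ≤ T := by exact_mod_cast (mem_range.1 hi).le
    calc ladder p₀ q i ≤ p₀ + i * q := ladder_le_add_mul hp0 hp1 hq0 hq1 i
      _ ≤ b * thr + T * q := by nlinarith
      _ ≤ 2 * b * thr := by linarith
  -- ### the lower window: `λ_i ≥ 1/4`
  -- Markov at the top rung
  have hlamT : 1 / 2 ≤ (n.choose k : ℝ) * ladder p₀ q (T - 1) ^ C :=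
    hπT.trans (gnpProb_clique_le_lambda (hl0 _) (hl1 _))
  -- `C(n,k) thr^C ≤ 1`, so `p_{T-1} ≥ thr/2`
  have hthrC : (n.choose k : ℝ) * thr ^ C ≤ 1 := by
    have h := choose_mul_threshold_pow_le hk hn1 (zero_le_one (α := ℝ))
    rw [one_mul, one_pow] at h
    exact h
  have hchoose0 : (0 : ℝ) < n.choose k := by
    have : 0 < n.choose k := Nat.choose_pos (by omega)
    exact_mod_cast this
  -- name the top rung `P`
  obtain ⟨P, hPdef⟩ : ∃ P : ℝ, P = ladder p₀ q (T - 1) := ⟨_, rfl⟩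
  have hP0 : 0 ≤ P := by rw [hPdef]; exact hl0 _
  have hlamT' : 1 / 2 ≤ (n.choose k : ℝ) * P ^ C := by rw [hPdef]; exact hlamT
  have hPthr : thr / 2 ≤ P := by
    have h2C : (2 : ℝ) ≤ 2 ^ C := by
      calc (2 : ℝ) = 2 ^ 1 := (pow_one _).symm
        _ ≤ 2 ^ C := pow_le_pow_right₀ (by norm_num) hC1
    have hthrC' : thr ^ C ≤ 1 / (n.choose k : ℝ) := by
      rw [le_div_iff₀ hchoose0, mul_comm]; exact hthrC
    have hPC : 1 / (2 * (n.choose k : ℝ)) ≤ P ^ C := by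
      rw [div_le_iff₀ (by positivity)]; linarith
    have h1 : (thr / 2) ^ C ≤ P ^ C := by
      calc (thr / 2) ^ C = thr ^ C / 2 ^ C := div_pow _ _ _
        _ ≤ thr ^ C / 2 := div_le_div_of_nonneg_left (pow_nonneg hthr0.le _) (by norm_num) h2C
        _ ≤ (1 / (n.choose k : ℝ)) / 2 := by gcongr
        _ = 1 / (2 * (n.choose k : ℝ)) := by rw [div_div, mul_comm]
        _ ≤ P ^ C := hPC
    exact (pow_le_pow_iff_left₀ (by positivity) hP0 (by omega)).1 h1
  have hPpos : 0 < P := lt_of_lt_of_le (by positivity) hPthr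
  -- `T q ≤ P/(2C)` and `p₀ ≥ P − T q`
  have hTqP : (T : ℝ) * q * (2 * C) ≤ P := by
    have h1 : (T : ℝ) * q * (4 * C) ≤ thr := by
      have := hTq
      rwa [le_div_iff₀ (by positivity)] at this
    linarith
  have hp0_low : P - T * q ≤ p₀ := by
    have h := ladder_le_add_mul hp0 hp1 hq0 hq1 (T - 1)
    rw [← hPdef] at h
    have hT1 : ((T - 1 : ℕ) : ℝ) ≤ T := by exact_mod_cast Nat.sub_le T 1
    have h2 : ((T - 1 : ℕ) : ℝ) * q ≤ (T : ℝ) * q := mul_le_mul_of_nonneg_right hT1 hq0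
    linarith
  have hlam0 : 1 / 4 ≤ (n.choose k : ℝ) * p₀ ^ C := by
    -- Bernoulli: `(1 − x)^C ≥ 1 − C x` with `x = Tq/P ≤ 1/(2C)`
    obtain ⟨x, hxdef⟩ : ∃ x : ℝ, x = (T : ℝ) * q / P := ⟨_, rfl⟩
    have hx0 : 0 ≤ x := by rw [hxdef]; positivity
    have hxle : x ≤ 1 / (2 * C) := by
      rw [hxdef, div_le_iff₀ hPpos]
      have : (T : ℝ) * q ≤ P / (2 * C) := by
        rw [le_div_iff₀ (by positivity)]; exact hTqP
      calc (T : ℝ) * q ≤ P / (2 * C) := this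
        _ = 1 / (2 * C) * P := by ring
    have hx1 : x ≤ 1 := hxle.trans (by rw [div_le_one (by positivity)]; linarith [hC1r])
    have hbern : 1 - (C : ℝ) * x ≤ (1 - x) ^ C := by
      have h := one_add_mul_le_pow (show (-2 : ℝ) ≤ -x by linarith) C
      rw [show (1 : ℝ) + -x = 1 - x by ring, show (1 : ℝ) + (C : ℝ) * -x = 1 - C * x by ring] at h
      exact h
    have hhalf : (1 : ℝ) / 2 ≤ 1 - (C : ℝ) * x := by
      have : (C : ℝ) * x ≤ 1 / 2 := by
        calc (C : ℝ) * x ≤ C * (1 / (2 * C)) := mul_le_mul_of_nonneg_left hxle hC0.le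
          _ = 1 / 2 := by field_simp
      linarith
    have hPx : P * (1 - x) = P - T * q := by
      rw [hxdef]; field_simp
    have hp0ge : P * (1 - x) ≤ p₀ := by rw [hPx]; exact hp0_low
    have hP1x : 0 ≤ P * (1 - x) := mul_nonneg hP0 (by linarith)
    calc (1 : ℝ) / 4 = 1 / 2 * (1 / 2) := by norm_num
      _ ≤ (n.choose k : ℝ) * P ^ C * (1 - (C : ℝ) * x) :=
          mul_le_mul hlamT' hhalf (by norm_num) (by positivity)
      _ ≤ (n.choose k : ℝ) * P ^ C * (1 - x) ^ C :=
          mul_le_mul_of_nonneg_left hbern (by positivity)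
      _ = (n.choose k : ℝ) * (P * (1 - x)) ^ C := by rw [mul_pow]; ring
      _ ≤ (n.choose k : ℝ) * p₀ ^ C :=
          mul_le_mul_of_nonneg_left (pow_le_pow_left₀ hP1x hp0ge C) hchoose0.le
  -- conclude
  intro i hi
  refine ⟨hlam0.trans ?_, hupper i hi⟩
  exact mul_le_mul_of_nonneg_left (pow_le_pow_left₀ hp0 (le_ladder hp1 hq0 hq1 i) C) hchoose0.le

/-! ### The mean rung error in the window -/

/-- **Mean error in the window.**  For any Boolean `g` with the `thm1_sparse_relative`-shaped pointwise
bound (slack `θ ∈ [0, 1/50]`, sprinkle `q`) along a balanced ladder of `T ≥ 100` rungs inside the critical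
window (`λ_i ≥ 1/4`, `p_i ≤ 2b·n^{-2/(k-1)}`, `32K₂ ≤ n`): the mean error is `≥ 1/64`. -/
theorem mean_error_ge_of_window {n k T : ℕ} (hn : 1 ≤ n) (hT : 100 ≤ T)
    {p₀ q θ b K₂ : ℝ} (hp0 : 0 ≤ p₀) (hp1 : p₀ ≤ 1) (hq0 : 0 ≤ q) (hq1 : q ≤ 1)
    (hθ0 : 0 ≤ θ) (hθ : θ ≤ 1 / 50)
    (hK₂ : ∀ p : ℝ, 0 ≤ p → p ≤ 1 → p ≤ 2 * b * (n : ℝ) ^ (-(2 : ℝ) / ((k : ℝ) - 1)) →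
      ∑ x, gnpWeight n p x * (cliqueCount n k x : ℝ) ^ 2 ≤
        (n.choose k : ℝ) * p ^ k.choose 2 + ((n.choose k : ℝ) * p ^ k.choose 2) ^ 2 + K₂ / n)
    (hK₂0 : 0 ≤ K₂) (hK₂n : 32 * K₂ ≤ n)
    (hwin : ∀ i ∈ range T, 1 / 4 ≤ (n.choose k : ℝ) * ladder p₀ q i ^ k.choose 2 ∧
      ladder p₀ q i ≤ 2 * b * (n : ℝ) ^ (-(2 : ℝ) / ((k : ℝ) - 1)))
    (hbal : ∑ i ∈ range T, gnpProb n (ladder p₀ q i) (univ.filter fun x => cliqueFn n k x = true) =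
      T / 2)
    (g : ((⊤ : SimpleGraph (Fin n)).edgeSet → Bool) → Bool)
    (hpt : ∀ x, kSubsetProb n k (fun A => g (x ⊔ cliqueVec A) = true) ≤
      θ + gnpProb n q (univ.filter fun y => g (x ⊔ y) = true)) :
    1 / 64 ≤ (∑ i ∈ range T, gnpProb n (ladder p₀ q i) (univ.filter fun x => g x ≠ cliqueFn n k x)) / T := by
  classical
  have hn0 : (0 : ℝ) < n := by exact_mod_cast hn
  set e : ℕ → ℝ := fun i => gnpProb n (ladder p₀ q i) (univ.filter fun x => g x ≠ cliqueFn n k x)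
    with he
  set π : ℕ → ℝ := fun i => gnpProb n (ladder p₀ q i) (univ.filter fun x => cliqueFn n k x = true)
    with hπ
  have hl0 : ∀ i, 0 ≤ ladder p₀ q i := fun i => ladder_nonneg hp0 hp1 hq0 hq1 i
  have hl1 : ∀ i, ladder p₀ q i ≤ 1 := fun i => ladder_le_one hp1 hq1 i
  have he0 : ∀ i ∈ range T, 0 ≤ e i := fun i _ => gnpProb_nonneg (hl0 i) (hl1 i) _
  have hπ0 : ∀ i ∈ range T, 0 ≤ π i := fun i _ => gnpProb_nonneg (hl0 i) (hl1 i) _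
  have hKn : K₂ / n ≤ 1 / 32 := by
    rw [div_le_iff₀ hn0]; linarith
  -- the rung inequalities with the uniform ratio `R = 5/2`
  have hrung : ∀ i, i + 1 < T → 1 - 5 / 2 * Real.sqrt (e i) ≤ θ + π (i + 1) + e (i + 1) := by
    intro i hi
    obtain ⟨hlam, hup⟩ := hwin i (mem_range.2 (by omega))
    set lam := (n.choose k : ℝ) * ladder p₀ q i ^ k.choose 2 with hlamdef
    set M := lam + lam ^ 2 + K₂ / n with hM
    have hlam_pos : 0 < lam := lt_of_lt_of_le (by norm_num) hlam
    have hM0 : 0 ≤ M := by positivity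
    have hsec := hK₂ (ladder p₀ q i) (hl0 i) (hl1 i) hup
    have hstep := rungStep_holds n k (ladder p₀ q i) q θ M g (hl0 i) (hl1 i) hq0 hq1 hlam_pos hM0 hpt hsec
    rw [← ladder_succ] at hstep
    -- `√M/λ ≤ 5/2`
    have hratio : Real.sqrt M / lam ≤ 5 / 2 := by
      rw [div_le_iff₀ hlam_pos]
      have hM' : M ≤ (5 / 2 * lam) ^ 2 := by
        rw [hM]
        nlinarith [sq_nonneg (lam - 1 / 4)]
      calc Real.sqrt M ≤ Real.sqrt ((5 / 2 * lam) ^ 2) := Real.sqrt_le_sqrt hM'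
        _ = 5 / 2 * lam := Real.sqrt_sq (by positivity)
    have hsq0 : 0 ≤ Real.sqrt (e i) := Real.sqrt_nonneg _
    have : 1 - 5 / 2 * Real.sqrt (e i) ≤ 1 - Real.sqrt M / lam * Real.sqrt (e i) := by
      nlinarith [mul_le_mul_of_nonneg_right hratio hsq0]
    exact this.trans hstep
  have hsum := rung_sum_bound (by omega) hθ0 (by norm_num : (0 : ℝ) ≤ 5 / 2) e π he0 hπ0 hbal hrung
  have hē0 : 0 ≤ (∑ i ∈ range T, e i) / T := div_nonneg (sum_nonneg he0) (Nat.cast_nonneg T)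
  exact mean_error_ge hē0 hθ hT (le_refl (5 / 2 : ℝ)) hsum

end Summit.PneNP.PneNP.Theorems.NegLimitedDoor.AmplifiedWindowBase
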